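import Summits.CriticalPhenomena.CardyFormulaZ2.Theorems.CardyIKTransportCornerLineDescentFreezeBlocks

/-!
# The frozen end `p = 0` of the corner line, part 3: blocks, their colours, and the coin-driven block bonds

Support file (Freeze groundwork, part 3 of 4) for the line `symmetric-seed-second-order` of the crux
`CardyIKTransport.CornerLineDescent` (stmt-CriticalPhenomena-10964), serving the registered stub
`stub_FreezeHomogenisation`.  Given flip enumerations `eA`, `eB` of the column and row bits (part 2), every cell `v`
gets a BLOCK INDEX `blockIdx eA eB v = (runIdx v0, runIdx v1)`; with no syndromes the colour is the block parity
(`gaugeColour_iff_blockParity`: black blocks are one parity class of `i + j`, a checkerboard of the renewal product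
grid); the corner cell of block `(i,j)` is the lower-left cell of the face at the grid vertex `(X_{i+1}, Y_{j+1})`;
the BLACK-BLOCK BOND CONFIGURATION `blockBonds ω eA eB` opens the diagonal bond `(i,j)—(i+1,j+1)` iff the coin of that
corner cell is off and the anti-diagonal `(i,j+1)—(i+1,j)` iff it is on (one fair coin per grid vertex; only the pair
that is black matters); and EVERY GAUGE EDGE IS A BLOCK MOVE (anchor `frozen_blockStep`: same block, or an open block
bond), while conversely an open block bond from the parity class of a black cell is realised by a gauge edge
(`exists_adj_of_mem_blockBonds`).  Under `(i,j) ↦ (m,n)`, `i = m − n`, `j = m + n + c`, the black blocks and their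
bonds are the nearest-neighbour graph `ℤ²`.  Part 4: windowed connectivity identification.  References: route file
`Theses/CardyIKTransport.lean` (items 10964, 4967); `Cruxes/CornerLineDescent/Disproof.lean` §F.
-/

noncomputable section

namespace Summit.CriticalPhenomena.CardyFormulaZ2.Theorems.CornerLineDescent.SymmetricSeed

open scoped BigOperators Topology Classical MeasureTheory ProbabilityTheory ENNReal NNReal
open Filter Set Function MeasureTheory
open Literature.Probability.Percolation (sitePercolation bondPercolation half BondConfig embDomainCrossing rectangle)
open Literature.Probability.LatticeModels
open Literature.Probability.RandomPlanarGeometry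


namespace Freeze

/-- The BLOCK INDEX `(i, j)` of the cell `v`: run index of `v0` among the column runs, of `v1` among the row
runs. [folklore] -/
def blockIdx {A B : Set ℤ} (eA : FlipEnum A) (eB : FlipEnum B) (v : Site 2) : ℤ × ℤ :=
  (eA.runIdx (v 0), eB.runIdx (v 1))

/-- COLOUR IS A BLOCK PARITY: with no syndromes, the cell `v` in block `(i, j)` is black iff
`Xor (A_{X_0} ⊕ B_{Y_0}) (Odd (i + j))` — black blocks form one parity class of the product grid, a checkerboard.
[folklore] -/
theorem gaugeColour_iff_blockParity {ω : Bits} (h : ω.2.2.1 = ∅) (eA : FlipEnum ω.1) (eB : FlipEnum ω.2.1)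
    (v : Site 2) :
    gaugeColour ω v ↔
      Xor (Xor (eA.pos 0 ∈ ω.1) (eB.pos 0 ∈ ω.2.1)) (Odd ((blockIdx eA eB v).1 + (blockIdx eA eB v).2)) := by
  rw [gaugeColour_iff_of_empty h, eA.mem_iff_even_runIdx, eB.mem_iff_even_runIdx, Int.odd_add]
  simp only [blockIdx, Xor, ← Int.not_even_iff_odd]
  tauto

/-- BLACKNESS IS CONSTANT ON PARITY CLASSES: two cells whose block indices have the same parity of `i + j` have the
same colour (no syndromes). [folklore] -/
theorem gaugeColour_iff_of_blockParity_eq {ω : Bits} (h : ω.2.2.1 = ∅) (eA : FlipEnum ω.1) (eB : FlipEnum ω.2.1)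
    {u v : Site 2}
    (hp : Even ((blockIdx eA eB u).1 + (blockIdx eA eB u).2 - ((blockIdx eA eB v).1 + (blockIdx eA eB v).2))) :
    (gaugeColour ω u ↔ gaugeColour ω v) := by
  rw [gaugeColour_iff_blockParity h eA eB, gaugeColour_iff_blockParity h eA eB]
  have : Odd ((blockIdx eA eB u).1 + (blockIdx eA eB u).2) ↔ Odd ((blockIdx eA eB v).1 + (blockIdx eA eB v).2) := by
    rw [Int.even_sub] at hp
    simp only [← Int.not_even_iff_odd]
    tauto
  simp only [Xor]
  tauto


variable {A B : Set ℤ}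

/-- The TOP-RIGHT CELL of the block `(i, j)` = the lower-left cell of the face sitting at the grid vertex
`(X_{i+1}, Y_{j+1})` where the blocks `(i,j)`, `(i+1,j+1)` (and `(i+1,j)`, `(i,j+1)`) meet. [folklore] -/
def cornerCell (eA : FlipEnum A) (eB : FlipEnum B) (i j : ℤ) : Site 2 :=
  ![eA.pos (i + 1) - 1, eB.pos (j + 1) - 1]

/-- The corner cell of block `(i, j)` lies in block `(i, j)`. [folklore] -/
@[simp] theorem blockIdx_cornerCell (eA : FlipEnum A) (eB : FlipEnum B) (i j : ℤ) :
    blockIdx eA eB (cornerCell eA eB i j) = (i, j) := by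
  simp [blockIdx, cornerCell, FlipEnum.runIdx_pos_add_one_sub_one]

/-- Its north-east neighbour lies in block `(i+1, j+1)`. [folklore] -/
@[simp] theorem blockIdx_cornerCell_add_one_one (eA : FlipEnum A) (eB : FlipEnum B) (i j : ℤ) :
    blockIdx eA eB (cornerCell eA eB i j + ![1, 1]) = (i + 1, j + 1) := by
  simp [blockIdx, cornerCell, FlipEnum.runIdx_pos]

/-- Its east neighbour lies in block `(i+1, j)`. [folklore] -/
@[simp] theorem blockIdx_cornerCell_add_one_zero (eA : FlipEnum A) (eB : FlipEnum B) (i j : ℤ) :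
    blockIdx eA eB (cornerCell eA eB i j + ![1, 0]) = (i + 1, j) := by
  simp [blockIdx, cornerCell, FlipEnum.runIdx_pos, FlipEnum.runIdx_pos_add_one_sub_one]

/-- Its north neighbour lies in block `(i, j+1)`. [folklore] -/
@[simp] theorem blockIdx_cornerCell_add_zero_one (eA : FlipEnum A) (eB : FlipEnum B) (i j : ℤ) :
    blockIdx eA eB (cornerCell eA eB i j + ![0, 1]) = (i, j + 1) := by
  simp [blockIdx, cornerCell, FlipEnum.runIdx_pos, FlipEnum.runIdx_pos_add_one_sub_one]

/-- A cell at which BOTH bits flip is the corner cell of its block (a grid vertex sits at its top-right). [folklore] -/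
theorem eq_cornerCell_of_not_iff (eA : FlipEnum A) (eB : FlipEnum B) {u : Site 2} {k l : ℤ}
    (hk : u 0 = k) (hl : u 1 = l) (hA : ¬ (k ∈ A ↔ k + 1 ∈ A)) (hB : ¬ (l ∈ B ↔ l + 1 ∈ B)) :
    u = cornerCell eA eB (eA.runIdx k) (eB.runIdx l) := by
  have h0 := eA.eq_runEnd_of_not_iff hA
  have h1 := eB.eq_runEnd_of_not_iff hB
  ext m; fin_cases m
  · simp only [cornerCell, Fin.zero_eta, Matrix.cons_val_zero]; rw [hk]; exact h0
  · simp only [cornerCell, Fin.mk_one, Matrix.cons_val_one, Matrix.cons_val_fin_one]; rw [hl]; exact h1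

/-- THE BLACK-BLOCK BOND CONFIGURATION read off the coins: the diagonal bond `(i,j)—(i+1,j+1)` is open iff the coin of
the corner cell of `(i,j)` is OFF, the anti-diagonal bond `(i,j+1)—(i+1,j)` iff that coin is ON (one fair coin per
grid vertex decides between the two diagonal pairs; only the pair that is black matters).  Under `(i,j) ↦ (m,n)`,
`i = m - n`, `j = m + n + c`, these are the nearest-neighbour bonds of `ℤ²`. [folklore] -/
def blockBonds (ω : Bits) (eA : FlipEnum ω.1) (eB : FlipEnum ω.2.1) : BondConfig (ℤ × ℤ) :=
  {b | ∃ i j : ℤ, (b = s((i, j), (i + 1, j + 1)) ∧ cornerCell eA eB i j ∉ ω.2.2.2.2) ∨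
    (b = s((i, j + 1), (i + 1, j)) ∧ cornerCell eA eB i j ∈ ω.2.2.2.2)}

/-- Block bonds join distinct blocks. [folklore] -/
theorem ne_of_mem_blockBonds {ω : Bits} {eA : FlipEnum ω.1} {eB : FlipEnum ω.2.1} {a c : ℤ × ℤ}
    (h : s(a, c) ∈ blockBonds ω eA eB) : a ≠ c := by
  rintro rfl
  obtain ⟨i, j, ⟨h, -⟩ | ⟨h, -⟩⟩ := h <;>
  · rcases Sym2.eq_iff.1 h with ⟨h1, h2⟩ | ⟨h1, h2⟩ <;>
    · have := (Prod.ext_iff.1 (h1.symm.trans h2)).1; simp only at this; omega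

/-- Block bonds preserve the parity of `i + j` (they are diagonal). [folklore] -/
theorem even_of_mem_blockBonds {ω : Bits} {eA : FlipEnum ω.1} {eB : FlipEnum ω.2.1} {a c : ℤ × ℤ}
    (h : s(a, c) ∈ blockBonds ω eA eB) : Even (a.1 + a.2 - (c.1 + c.2)) := by
  obtain ⟨i, j, ⟨h, -⟩ | ⟨h, -⟩⟩ := h
  · rcases Sym2.eq_iff.1 h with ⟨rfl, rfl⟩ | ⟨rfl, rfl⟩
    · exact ⟨-1, by ring⟩
    · exact ⟨1, by ring⟩
  · rcases Sym2.eq_iff.1 h with ⟨rfl, rfl⟩ | ⟨rfl, rfl⟩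
    · exact ⟨0, by ring⟩
    · exact ⟨0, by ring⟩

/-- EVERY GAUGE EDGE IS A BLOCK MOVE (no syndromes): if `s(u, v)` is black then either `u`, `v` lie in the same
block, or their blocks are joined by an OPEN block bond (the edge is then the coin-chosen diagonal of the grid vertex
between the two blocks). [folklore] -/
theorem blockStep_of_mem_gaugeEdges {ω : Bits} (h : ω.2.2.1 = ∅) (eA : FlipEnum ω.1) (eB : FlipEnum ω.2.1)
    {u v : Site 2} (he : s(u, v) ∈ gaugeEdges ω) :
    blockIdx eA eB u = blockIdx eA eB v ∨ s(blockIdx eA eB u, blockIdx eA eB v) ∈ blockBonds ω eA eB := by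
  -- reduce to a forward step
  wlog hst : gaugeColour ω u ∧ gaugeColour ω v ∧ Step ω u v generalizing u v
  · rcases (mem_gaugeEdges_iff ω u v).1 he with h' | h'
    · exact this he h'
    · rcases this (Sym2.eq_swap ▸ he) h' with h1 | h1
      · exact Or.inl h1.symm
      · exact Or.inr (Sym2.eq_swap ▸ h1)
  obtain ⟨hu, hv, hst⟩ := hst
  have hcol := gaugeColour_iff_of_empty h
  rcases hst with rfl | rfl | ⟨rfl, hc⟩ | ⟨rfl, hc⟩
  · -- east: bits at u0, u0+1 agree
    have hA : (u 0 ∈ ω.1 ↔ u 0 + 1 ∈ ω.1) := ((mem_gaugeEdges_east_iff_of_empty h u).1 he).2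
    left
    simp only [blockIdx, Pi.add_apply, Matrix.cons_val_zero, Matrix.cons_val_one, Matrix.cons_val_fin_one,
      add_zero, eA.runIdx_add_one_of_iff hA]
  · have hB : (u 1 ∈ ω.2.1 ↔ u 1 + 1 ∈ ω.2.1) := ((mem_gaugeEdges_north_iff_of_empty h u).1 he).2
    left
    simp only [blockIdx, Pi.add_apply, Matrix.cons_val_zero, Matrix.cons_val_one, Matrix.cons_val_fin_one,
      add_zero, eB.runIdx_add_one_of_iff hB]
  · -- north-east: both bits flip or none does
    simp only [hcol, Pi.add_apply, Matrix.cons_val_zero, Matrix.cons_val_one, Matrix.cons_val_fin_one] at hu hv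
    by_cases hA : (u 0 ∈ ω.1 ↔ u 0 + 1 ∈ ω.1)
    · have hB : (u 1 ∈ ω.2.1 ↔ u 1 + 1 ∈ ω.2.1) := by simp only [Xor] at hu hv; tauto
      left
      simp only [blockIdx, Pi.add_apply, Matrix.cons_val_zero, Matrix.cons_val_one, Matrix.cons_val_fin_one,
        eA.runIdx_add_one_of_iff hA, eB.runIdx_add_one_of_iff hB]
    · have hB : ¬ (u 1 ∈ ω.2.1 ↔ u 1 + 1 ∈ ω.2.1) := by simp only [Xor] at hu hv; tauto
      right
      have hu' : u = cornerCell eA eB (eA.runIdx (u 0)) (eB.runIdx (u 1)) :=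
        eq_cornerCell_of_not_iff eA eB rfl rfl hA hB
      refine ⟨eA.runIdx (u 0), eB.runIdx (u 1), Or.inl ⟨?_, ?_⟩⟩
      · simp only [blockIdx, Pi.add_apply, Matrix.cons_val_zero, Matrix.cons_val_one, Matrix.cons_val_fin_one,
          (eA.runIdx_add_one_of_not_iff hA).1, (eB.runIdx_add_one_of_not_iff hB).1]
      · rw [← hu', ← gaugeCoin_iff']; exact hc
  · -- south-east: `v = u + (1,-1)`, the face is at `w = u + (0,-1)`; both bits flip at `w` or none does
    simp only [hcol, Pi.add_apply, Matrix.cons_val_zero, Matrix.cons_val_one, Matrix.cons_val_fin_one] at hu hv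
    have e1 : u 1 = u 1 + -1 + 1 := by ring
    by_cases hA : (u 0 ∈ ω.1 ↔ u 0 + 1 ∈ ω.1)
    · have hB : (u 1 + -1 ∈ ω.2.1 ↔ u 1 + -1 + 1 ∈ ω.2.1) := by
        rw [← e1]; simp only [Xor] at hu hv; tauto
      left
      have := eB.runIdx_add_one_of_iff hB
      rw [← e1] at this
      simp only [blockIdx, Pi.add_apply, Matrix.cons_val_zero, Matrix.cons_val_one, Matrix.cons_val_fin_one,
        eA.runIdx_add_one_of_iff hA, this]
    · have hB : ¬ (u 1 + -1 ∈ ω.2.1 ↔ u 1 + -1 + 1 ∈ ω.2.1) := by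
        rw [← e1]; simp only [Xor] at hu hv; tauto
      right
      have hiA := (eA.runIdx_add_one_of_not_iff hA).1
      have hjB := (eB.runIdx_add_one_of_not_iff hB).1
      rw [← e1] at hjB
      -- the face cell `w = u + (0,-1)` is a corner cell
      have hw : u + ![0, -1] = cornerCell eA eB (eA.runIdx (u 0)) (eB.runIdx (u 1 + -1)) :=
        eq_cornerCell_of_not_iff eA eB (by simp) (by simp) hA hB
      refine ⟨eA.runIdx (u 0), eB.runIdx (u 1 + -1), Or.inr ⟨?_, ?_⟩⟩
      · simp only [blockIdx, Pi.add_apply, Matrix.cons_val_zero, Matrix.cons_val_one, Matrix.cons_val_fin_one,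
          hiA, hjB]
      · rw [← hw, ← gaugeCoin_iff']; exact hc


open Literature.Probability.Percolation (openGraph openGraph_adj openConnIn)

/-- AN OPEN BLOCK BOND IS REALISED BY A GAUGE EDGE between a cell of the first block and a cell of the second,
provided the first block has the colour parity of a black cell `u` (then both blocks are black). [folklore] -/
theorem exists_adj_of_mem_blockBonds {ω : Bits} (h : ω.2.2.1 = ∅) (eA : FlipEnum ω.1) (eB : FlipEnum ω.2.1)
    {u : Site 2} (hu : gaugeColour ω u) {a c : ℤ × ℤ} (ha : blockIdx eA eB u = a)
    (hb : s(a, c) ∈ blockBonds ω eA eB) :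
    ∃ x y : Site 2, blockIdx eA eB x = a ∧ blockIdx eA eB y = c ∧ (openGraph (gaugeEdges ω)).Adj x y := by
  -- colour of any cell from the parity of its block relative to `u`
  have hblack : ∀ x : Site 2, Even ((blockIdx eA eB x).1 + (blockIdx eA eB x).2 - (a.1 + a.2)) →
      gaugeColour ω x := fun x hx =>
    (gaugeColour_iff_of_blockParity_eq h eA eB (u := x) (v := u) (by rwa [ha])).2 hu
  have hpar := even_of_mem_blockBonds hb
  obtain ⟨i, j, ⟨he, hc⟩ | ⟨he, hc⟩⟩ := hb
  · -- main diagonal at the corner cell of `(i, j)`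
    set x := cornerCell eA eB i j with hx
    have hxi : blockIdx eA eB x = (i, j) := blockIdx_cornerCell eA eB i j
    have hyi : blockIdx eA eB (x + ![1, 1]) = (i + 1, j + 1) := blockIdx_cornerCell_add_one_one eA eB i j
    have hxy : s(x, x + ![1, 1]) ∈ gaugeEdges ω := by
      rw [mem_gaugeEdges_northEast]
      refine ⟨hblack _ ?_, hblack _ ?_, hc⟩
      · rw [hxi]; rcases Sym2.eq_iff.1 he with ⟨rfl, rfl⟩ | ⟨rfl, rfl⟩
        · simp
        · simp only at hpar ⊢; obtain ⟨r, hr⟩ := hpar; exact ⟨-r, by omega⟩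
      · rw [hyi]; rcases Sym2.eq_iff.1 he with ⟨rfl, rfl⟩ | ⟨rfl, rfl⟩
        · exact ⟨1, by ring⟩
        · simp
    have hadj : (openGraph (gaugeEdges ω)).Adj x (x + ![1, 1]) := by
      rw [openGraph_adj]; refine ⟨hxy, fun heq => ?_⟩; have := congrFun heq 0; simp at this
    rcases Sym2.eq_iff.1 he with ⟨rfl, rfl⟩ | ⟨rfl, rfl⟩
    · exact ⟨x, x + ![1, 1], hxi, hyi, hadj⟩
    · exact ⟨x + ![1, 1], x, hyi, hxi, hadj.symm⟩
  · -- anti-diagonal at the corner cell of `(i, j)`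
    set x := cornerCell eA eB i j with hx
    have hxi : blockIdx eA eB (x + ![0, 1]) = (i, j + 1) := blockIdx_cornerCell_add_zero_one eA eB i j
    have hyi : blockIdx eA eB (x + ![1, 0]) = (i + 1, j) := blockIdx_cornerCell_add_one_zero eA eB i j
    have hxy : s(x + ![0, 1], x + ![1, 0]) ∈ gaugeEdges ω := by
      rw [mem_gaugeEdges_southEast]
      refine ⟨hblack _ ?_, hblack _ ?_, hc⟩
      · rw [hxi]; rcases Sym2.eq_iff.1 he with ⟨rfl, rfl⟩ | ⟨rfl, rfl⟩
        · simp
        · simp only at hpar ⊢; obtain ⟨r, hr⟩ := hpar; exact ⟨-r, by omega⟩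
      · rw [hyi]; rcases Sym2.eq_iff.1 he with ⟨rfl, rfl⟩ | ⟨rfl, rfl⟩
        · exact ⟨0, by ring⟩
        · simp
    have hadj : (openGraph (gaugeEdges ω)).Adj (x + ![0, 1]) (x + ![1, 0]) := by
      rw [openGraph_adj]; refine ⟨hxy, fun heq => ?_⟩; have := congrFun heq 0; simp at this
    rcases Sym2.eq_iff.1 he with ⟨rfl, rfl⟩ | ⟨rfl, rfl⟩
    · exact ⟨x + ![0, 1], x + ![1, 0], hxi, hyi, hadj⟩
    · exact ⟨x + ![1, 0], x + ![0, 1], hyi, hxi, hadj.symm⟩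

end Freeze

/-- ANCHOR OF PART 3 (registered sub-goal). EVERY GAUGE EDGE OF THE FROZEN GAUGE IS A BLOCK MOVE: with no syndromes,
if `s(u, v)` is black then `u`, `v` lie in the same block of the renewal product grid, or their blocks are joined by
an open block bond (the coin-chosen diagonal at the grid vertex between them). [folklore] -/
theorem frozen_blockStep : ∀ (ω : Bits), ω.2.2.1 = ∅ → ∀ (eA : Freeze.FlipEnum ω.1) (eB : Freeze.FlipEnum ω.2.1) (u v : Site 2), s(u, v) ∈ gaugeEdges ω → (Freeze.blockIdx eA eB u = Freeze.blockIdx eA eB v ∨ s(Freeze.blockIdx eA eB u, Freeze.blockIdx eA eB v) ∈ Freeze.blockBonds ω eA eB) :=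
  fun _ h eA eB _ _ he => Freeze.blockStep_of_mem_gaugeEdges h eA eB he

end Summit.CriticalPhenomena.CardyFormulaZ2.Theorems.CornerLineDescent.SymmetricSeed
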